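import Summits.CriticalPhenomena.PercolationContinuityZ3.Theorems.Transplant.KNCells2FacePrefix
import Summits.CriticalPhenomena.PercolationContinuityZ3.Theorems.Transplant.KNCells2Corridor
import HarnessLib

/-!
# Design (D), residue `hout_of_valid` (lead 14:35:13Z): after a valid history the EXPLORED REGION IS SEPARATED from the fresh habitat
# `Q_α(x) ∪ E^far_β(x,du)` of the examination of `x` (KN's (29)/(31)); hence the fresh chain regions are disjoint from the explored region, do
# not contain the root, and every vertex of the corridor world adjacent to them lies in `E_{v,x} ∪ H_{x,y}` (the generic half of the subbox
# side-condition `hout` of `isSubbox_Wcor_graph` / `isSubbox_Wt_graph` in the tube graph; the instance adds only the fibre radii)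

builds on p205010 (kernel theorem, internal audit signed; external expert review pending) — nothing in this file uses p205010.
Lane `prim-bschramm`, seat `prim-bschramm-p2`; helper file (`--supports stmt-CriticalPhenomena-4575`).

* `QSepGeom G Γ` — the two separation facts of the cube: cells of other macro-vertices and all stub zones of other macro-vertices are
  `G`-separated from `Q_a x` (p3-g2's planar `Cell_sep_Q` / `Zone_sep_Q`, all anchors);
* **`Valid₂.sep_Q`** (`Sep G (Vx h) (Q a (tgt e))`), **`Valid₂.sep_habitat`** (`Sep G (Vx h) (Q a (tgt e) ∪ Efar a' (tgt e) du)` for onward `du`);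
* corollaries for a fresh region `Dd ⊆ Q_a(x) ∪ Efar_{a'}(x,du)`: `disjoint_Vx_of_fresh`, `root_not_mem_of_fresh`, **`mem_of_adj_fresh`** (a vertex of
  `Ucor = Vx ∪ E_{v,x} ∪ H_{x,y}` adjacent to `Dd` lies in `E_{v,x} ∪ H_{x,y}`), `mem_Sx_of_adj_fresh` (likewise for `Sx`: in `E_{v,x} ∪ E^far`).
[cite: KozmaNitzan2024, §4 p. 26 ((29)), p. 31 ((31))]
-/

noncomputable section

open MeasureTheory ProbabilityTheory
open scoped ENNReal Classical

namespace Summit.CriticalPhenomena.PercolationContinuityZ3.Theorems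

namespace Transplant

namespace KNCells

open Literature.Probability.Percolation Literature.Probability.LatticeModels SimpleGraph GadgetSystem ProbeHistory HSiteScheme Contour

variable {V : Type*} [DecidableEq V]

/-- **Separation facts of the cube**: the cells and the stub zones of macro-vertices other than `x` are `G`-separated from `Q_a x` (any anchors).
[cite: KozmaNitzan2024, §4 p. 26 ((29)), p. 31 ((31): the stubs stop short of Q)] -/
structure QSepGeom {A : Type*} (G : SimpleGraph V) (Γ : CellGeom V A) : Prop where
  /-- cells of other macro-vertices are separated from the cube -/
  Cell_sep_Q : ∀ b a u x, u ≠ x → Sep G (Γ.Cell b u) (Γ.Q a x)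
  /-- stub zones of other macro-vertices are separated from the cube -/
  Zone_sep_Q : ∀ b a u δ x, u ≠ x → Sep G (Γ.Zone b u δ) (Γ.Q a x)

namespace KSchA

variable {A : Type*} {G : SimpleGraph V} [G.LocallyFinite] {S : KSchA V A} {FD : FaceData V A} {LD : LevelData V A}
variable (hL : LevelGeom G S.Γ FD LD) (hQ : QSepGeom G S.Γ)
variable {h : ProbeHistory V} {e : Site 2 × MDir} (hV : S.Valid₂ G h e) {a a' : A} {du : MDir} (hdu : du ∈ S.onward G h (tgt e))
include hV

section SepQ

include hQ

/-- **After a valid history the explored region is separated from the cube `Q_a(x)` of the examined `x = tgt e`** (any anchor).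
[cite: KozmaNitzan2024, §4 p. 26 ((29))] -/
theorem Valid₂.sep_Q (a : A) : Sep G (S.Vx G h) (S.Γ.Q a (tgt e)) := by
  intro y hy b hb
  obtain ⟨det, hv, -, hsub⟩ := hV.cover
  have hy' := hsub (Finset.mem_coe.2 hy)
  simp only [CellGeom.Cover, Set.mem_iUnion, Set.mem_union, exists_prop, Finset.mem_coe] at hy'
  obtain ⟨u, hu, h' | ⟨δ', h'⟩⟩ := hy'
  · have huv : u ≠ tgt e := fun h'' => hv (h'' ▸ hu)
    exact hQ.Cell_sep_Q _ _ _ _ huv y h' b hb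
  · have huv : u ≠ tgt e := fun h'' => hv (h'' ▸ hu)
    exact hQ.Zone_sep_Q _ _ _ _ _ huv y h' b hb

include hL hdu

/-- **The explored region is separated from the fresh habitat `Q_a(x) ∪ E^far_{a'}(x, du)`** (onward `du`). [cite: KozmaNitzan2024, §4 pp. 26, 31] -/
theorem Valid₂.sep_habitat : Sep G (S.Vx G h) (S.Γ.Q a (tgt e) ∪ S.Γ.Efar a' (tgt e) du) := by
  intro y hy b hb
  rcases Finset.mem_union.1 hb with hb | hb
  · exact Valid₂.sep_Q hQ hV a y hy b hb
  · exact Valid₂.sep_Efar hL hV hdu y hy b hb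

/-- A fresh region inside the habitat is disjoint from the explored region. [folklore] -/
theorem disjoint_Vx_of_fresh {Dd : Finset V} (hD : Dd ⊆ S.Γ.Q a (tgt e) ∪ S.Γ.Efar a' (tgt e) du) : Disjoint Dd (S.Vx G h) := by
  rw [Finset.disjoint_left]
  intro v hv hvV
  exact (Valid₂.sep_habitat hL hQ hV hdu v hvV v (hD hv)).1 rfl

/-- The root lies outside every fresh region inside the habitat. [folklore] -/
theorem root_not_mem_of_fresh {Dd : Finset V} (hD : Dd ⊆ S.Γ.Q a (tgt e) ∪ S.Γ.Efar a' (tgt e) du) : S.Γ.root ∉ Dd := fun h' =>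
  Finset.disjoint_left.1 (disjoint_Vx_of_fresh hL hQ hV hdu hD) h' hV.root_mem

/-- **A vertex of the corridor world `Ucor = Vx ∪ E_{v,x} ∪ H_{x,y}` adjacent to a fresh region inside the habitat lies in `E_{v,x} ∪ H_{x,y}`**
(the generic half of the subbox side-condition in the tube graph). [cite: KozmaNitzan2024, §4 p. 31] -/
theorem mem_of_adj_fresh {Dd : Finset V} (hD : Dd ⊆ S.Γ.Q a (tgt e) ∪ S.Γ.Efar a' (tgt e) du) {b : A} {v x : V} (hv : v ∈ Dd)
    (hx : x ∈ S.Ucor G FD h e b a' du) (hadj : G.Adj x v) : x ∈ S.Γ.Ewv b e.1 e.2 ∪ FD.Hfull a' (tgt e) du := by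
  rw [Ucor, Finset.mem_union, Finset.mem_union] at hx
  rcases hx with (hx | hx) | hx
  · exact absurd hadj (Valid₂.sep_habitat hL hQ hV hdu x hx v (hD hv)).2
  · exact Finset.mem_union_left _ hx
  · exact Finset.mem_union_right _ hx

/-- Likewise for the support `Sx = Vx ∪ E_{v,x} ∪ E^far`: a vertex of `Sx` adjacent to a fresh region lies in `E_{v,x} ∪ E^far`. [folklore] -/
theorem mem_Sx_of_adj_fresh {Dd : Finset V} (hD : Dd ⊆ S.Γ.Q a (tgt e) ∪ S.Γ.Efar a' (tgt e) du) {b : A} {v x : V} (hv : v ∈ Dd)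
    (hx : x ∈ S.Sx G h e b a' du) (hadj : G.Adj x v) : x ∈ S.Γ.Ewv b e.1 e.2 ∪ S.Γ.Efar a' (tgt e) du := by
  rw [Sx, Finset.mem_union, Finset.mem_union] at hx
  rcases hx with (hx | hx) | hx
  · exact absurd hadj (Valid₂.sep_habitat hL hQ hV hdu x hx v (hD hv)).2
  · exact Finset.mem_union_left _ hx
  · exact Finset.mem_union_right _ hx

end SepQ

end KSchA

end KNCells

end Transplant

end Summit.CriticalPhenomena.PercolationContinuityZ3.Theorems

end
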